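import Summits.BirchSwinnertonDyer.BirchSwinnertonDyer.Theorems.SignedLowerHalvesSmallImageLowerHalfBothSignsRttKanGoodDepleteData
import HarnessLib

/-!
# Route `SignedLowerHalves`, crux L `SmallImageLowerHalfBothSigns` (item stmt-BirchSwinnertonDyer-23599), line `rtt_w3`,
# stub Kan₂ `stub_thetaLayerLambda_ns` — brick K2a (part 2): VATSAL'S CONDITION 1 is inherited by the FULL DEPLETION
# `ι₁G − a_ℓ ι_ℓ G + ℓ ι_{ℓ²} G` at a GOOD prime `ℓ` (no simple-roots hypothesis)

Width seat `bsd-line-slh-p3-w3` g11 under LEAD `cruxlead-stmt-BirchSwinnertonDyer-23599` g0 (cell `bsd-ssimc`). ROUTE-INDEPENDENT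
helper (`--supports stmt-BirchSwinnertonDyer-23599`); THEOREMS ONLY — no definition, no named fact, no `sorry`; closes nothing;
BSD is not proved by any of this.

WHY. Kan₂ applies Vatsal's congruence to the `S₀`-DEPLETED forms of `f_W` and of its partner at the common level
`∏_{ℓ∈S₀} ℓ^{max(2,v_ℓ)}`; each needs Vatsal's Condition 1. The tree (cell `bsd-addord`, `KimAtThree…{MultiStab,Deplete}ConditionOne`)
transports Condition 1 through ONE stabilisation `ι₁ − βι_q` off the level (needs `α ≠ β`) and through `ι₁ − a_ℓι_ℓ` at a prime of the
NEWFORM's level; at a GOOD prime `ℓ ∤ N` Kan₂ needs the FULL depletion `D G = ι₁G − a_ℓ(G)ι_ℓG + ℓι_{ℓ²}G ∈ S₂(Γ₀(Nℓ²))` (`U_ℓ D G = 0`).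
THIS FILE (part 2; part 1 = `…RttKanGoodDepleteData`, the Hecke data): Condition 1 `G ↦ D G` with NO simple-roots hypothesis: for `V = ker(T_ℓ − a)` at level `N`,
a root `β` of `X² − aX + ℓ`, `E = ι₁ − βι_ℓ`, the old forms of the newform `g` at level `Nℓ²` lie in `D(V) + E(V) + ι_ℓ(V)`; on
`Y = E(V) + ι_ℓ(V)` the operator `U_ℓ` is stable with `U² − aU + ℓ = 0`, hence injective (`ℓ ≠ 0`), so a generalised `U_ℓ`-null
vector of the old space is `D w₀`; `D` is injective and commutes with `T_p` (`p ≠ ℓ`), and Condition 1 of `G` gives `w₀ ∈ ℂG`.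

* ★ `hasSimpleHeckeGenEigenspace_goodDeplete_of_hasSimpleHeckeGenEigenspace`.

References: [Vatsal1999] (1.2) Condition 1; [AtkinLehner1970] Thm. 3–5; [DiamondShurman2005] Prop. 5.6.2, §5.7, Thm. 5.8.3;
[GreenbergVatsal2000] §1 (8) (the `Σ₀`-depleted form).
-/

set_option autoImplicit false
-- D-0017: single-problem summit, the namespace repeats the problem name by design.
set_option linter.dupNamespace false

noncomputable section

open scoped MatrixGroups ModularForm Classical NNReal

open CongruenceSubgroup Literature.NumberTheory.EllipticCurves Literature.NumberTheory.EllipticCurves.ModularForms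
open UpperHalfPlane hiding I

namespace Summit.BirchSwinnertonDyer.BirchSwinnertonDyer.Theorems.SmallImageRttKan

open Summit.BirchSwinnertonDyer.BirchSwinnertonDyer.Theorems.KimAtThreeDeepLowerOffStratumLevelLoweringConditionOne
open Summit.BirchSwinnertonDyer.BirchSwinnertonDyer.Theorems.KimAtThreeDeepLowerOffStratumLevelLoweringDoubleStabConditionOne
  (iota_iota)
open Summit.BirchSwinnertonDyer.BirchSwinnertonDyer.Theorems.KimAtThreeDeepLowerOffStratumLevelLoweringMultiStabConditionOne
  (pow_sub_smul_one_apply_comm)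

/-! ### §2 Condition 1 passes from `G` to its good-prime depletion -/

section Step

variable {M₀ N N' ℓ : ℕ} [NeZero M₀] [NeZero N] [NeZero N'] [NeZero ℓ] {g : CuspForm (Gamma0 M₀) 2} (hg : IsNewform0 g)
  (h1 : N * 1 ∣ N') (hℓ1 : N * ℓ ∣ N') (hℓ2 : N * (ℓ * ℓ) ∣ N')
include hg

/-- ★ **Condition 1 is inherited by the full depletion at a good prime.** Let `g ∈ S₂(Γ₀(M₀))` be a newform, `M₀ ∣ N`, and
`G ∈ S₂(Γ₀(N))` a normalised Hecke eigenform with `a_p(G) = a_p(g)` for every prime `p ∤ N`, satisfying Vatsal's Condition 1.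
Let `ℓ ∤ N` be a prime and `N' = Nℓ²`. Then `D G = ι₁ G − a_ℓ(G) ι_ℓ G + ℓ ι_{ℓ²} G ∈ S₂(Γ₀(N'))` satisfies Condition 1. Proof in the
module docstring (old forms of `g` at level `N'` lie in `D(V) + E(V) + ι_ℓ(V)`, `V = ker(T_ℓ − a_ℓ(g))`, `E = ι₁ − βι_ℓ`; `U_ℓ` is
injective on `E(V) + ι_ℓ(V)` since `U² − a_ℓU + ℓ = 0` there; `D` is injective and commutes with the `T_p`, `p ≠ ℓ`). NO hypothesis
`α ≠ β` is needed. [cite: Vatsal1999, (1.2) Condition 1] [cite: AtkinLehner1970, Thm. 4 and Thm. 5] [cite: DiamondShurman2005, Prop. 5.6.2 and Thm. 5.8.3] -/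
theorem hasSimpleHeckeGenEigenspace_goodDeplete_of_hasSimpleHeckeGenEigenspace (hM₀N : M₀ ∣ N) (hN' : N' = N * (ℓ * ℓ))
    {G : CuspForm (Gamma0 N) 2} (hGeig : IsHeckeEigenform G) (hGnorm : IsNormalized G)
    (hGC : HasSimpleHeckeGenEigenspace G) (hGg : ∀ p : ℕ, p.Prime → ¬ p ∣ N → cuspCoeff G p = cuspCoeff g p)
    (hℓ : ℓ.Prime) (hℓN : ¬ ℓ ∣ N) :
    HasSimpleHeckeGenEigenspace
      (iota N N' 1 2 h1 G - cuspCoeff G ℓ • iota N N' ℓ 2 hℓ1 G + (ℓ : ℂ) • iota N N' (ℓ * ℓ) 2 hℓ2 G) := by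
  set a : ℂ := cuspCoeff G ℓ with hadef
  have haℓ : a = cuspCoeff g ℓ := hGg ℓ hℓ hℓN
  have hℓM₀ : ¬ ℓ ∣ M₀ := fun h ↦ hℓN (h.trans hM₀N)
  have hℓ0 : (ℓ : ℂ) ≠ 0 := by exact_mod_cast hℓ.ne_zero
  -- a root `β` of `X² − aX + ℓ`, `α = a − β`, `αβ = ℓ`
  obtain ⟨β, hβ⟩ : ∃ β : ℂ, β ^ 2 - a * β + ℓ = 0 := by
    obtain ⟨s, hs⟩ := IsAlgClosed.exists_pow_nat_eq (a ^ 2 - 4 * (ℓ : ℂ)) two_pos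
    exact ⟨(a - s) / 2, by linear_combination (1 / 4 : ℂ) * hs⟩
  set α : ℂ := a - β with hαdef
  have hαβ : α * β = ℓ := by rw [hαdef]; linear_combination -hβ
  -- the three maps `D`, `E = ι₁ − βι_ℓ`, `J = ι_ℓ`
  set D : CuspForm (Gamma0 N) 2 →ₗ[ℂ] CuspForm (Gamma0 N') 2 :=
    iota N N' 1 2 h1 - a • iota N N' ℓ 2 hℓ1 + (ℓ : ℂ) • iota N N' (ℓ * ℓ) 2 hℓ2 with hD
  set E : CuspForm (Gamma0 N) 2 →ₗ[ℂ] CuspForm (Gamma0 N') 2 := iota N N' 1 2 h1 - β • iota N N' ℓ 2 hℓ1 with hE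
  set J : CuspForm (Gamma0 N) 2 →ₗ[ℂ] CuspForm (Gamma0 N') 2 := iota N N' ℓ 2 hℓ1 with hJ
  have hDv : ∀ v, D v = iota N N' 1 2 h1 v - a • iota N N' ℓ 2 hℓ1 v + (ℓ : ℂ) • iota N N' (ℓ * ℓ) 2 hℓ2 v := fun v ↦ rfl
  have hEv : ∀ v, E v = iota N N' 1 2 h1 v - β • iota N N' ℓ 2 hℓ1 v := fun v ↦ rfl
  have hJv : ∀ v, J v = iota N N' ℓ 2 hℓ1 v := fun v ↦ rfl
  -- the eigenvalues of `D G`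
  have hev : ∀ {p : ℕ}, p.Prime →
      heckeEigenvalue (iota N N' 1 2 h1 G - a • iota N N' ℓ 2 hℓ1 G + (ℓ : ℂ) • iota N N' (ℓ * ℓ) 2 hℓ2 G) p =
        if p = ℓ then 0 else cuspCoeff G p :=
    fun hp ↦ heckeEigenvalue_goodDeplete h1 hℓ1 hℓ2 hGeig hGnorm hN' hℓ hℓN hp
  change ∀ k : CuspForm (Gamma0 N') 2, _ → ∃ c : ℂ, k = c • D G
  intro k hk
  by_cases hk0 : k = 0
  · exact ⟨0, by rw [hk0, zero_smul]⟩
  -- off `N'` the generalised eigen-equations are honest, with eigenvalues `a_p(g)`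
  have hT : ∀ (p : ℕ) (hp : p.Prime), ¬ p ∣ N' →
      (haveI : NeZero p := ⟨hp.ne_zero⟩; heckeT (Gamma0 N') 2 p k) = (qExpansion 1 ⇑g).coeff p • k := by
    intro p hp hpN'
    haveI : NeZero p := ⟨hp.ne_zero⟩
    have hpℓ : p ≠ ℓ := by rintro rfl; exact hpN' (by rw [hN']; exact (dvd_mul_right p p).trans (dvd_mul_left _ N))
    have hpN : ¬ p ∣ N := fun h ↦ hpN' (by rw [hN']; exact h.mul_right _)
    obtain ⟨n, hn⟩ := hk p hp
    rw [hev hp, if_neg hpℓ, hGg p hp hpN] at hn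
    exact heckeT_apply_eq_smul_of_pow_apply_eq_zero hp hpN' hn
  obtain ⟨M', _, hM'N, g₁, hg₁, hcoef, hmem⟩ := exists_isNewform0_mem_span_of_eigenpacket hk0 hT
  -- strong multiplicity one: `M' = M₀`, `g₁ = g`
  have hfg : ∀ p : ℕ, p.Prime → ¬ p ∣ N' → heckeEigenvalue g p = heckeEigenvalue g₁ p := by
    intro p hp hpN
    rw [heckeEigenvalue_eq_coeff_of_isNormalized hg.2.2 hp (hg.2.1 p hp),
      heckeEigenvalue_eq_coeff_of_isNormalized hg₁.2.2 hp (hg₁.2.1 p hp), hcoef p hp hpN]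
  have hfin : {p : ℕ | p.Prime ∧ heckeEigenvalue g p ≠ heckeEigenvalue g₁ p}.Finite :=
    finite_setOf_prime_and_ne (NeZero.ne N') hfg
  have hMM' : M₀ = M' := IsNewform0.level_eq_of_heckeEigenvalue_eq_holds hg hg₁ hfin
  subst hMM'
  have hg₁g : g₁ = g := (IsNewform0.eq_of_heckeEigenvalue_eq_holds hg hg₁ hfin).symm
  rw [hg₁g] at hmem
  -- `V = ker(T_ℓ − a)` at level `N`; `Y = E V + J V`; `P = D V + Y`
  set V : Submodule ℂ (CuspForm (Gamma0 N) 2) := Module.End.eigenspace (heckeT (Gamma0 N) 2 ℓ) a with hVdef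
  have hV : ∀ {v : CuspForm (Gamma0 N) 2}, v ∈ V ↔ heckeT (Gamma0 N) 2 ℓ v = a • v := Module.End.mem_eigenspace_iff
  set Y : Submodule ℂ (CuspForm (Gamma0 N') 2) := V.map E ⊔ V.map J with hYdef
  set P : Submodule ℂ (CuspForm (Gamma0 N') 2) := V.map D ⊔ Y with hPdef
  have hJP : ∀ v ∈ V, iota N N' ℓ 2 hℓ1 v ∈ P := fun v hv ↦
    Submodule.mem_sup_right (Submodule.mem_sup_right ⟨v, hv, rfl⟩)
  have h1P : ∀ v ∈ V, iota N N' 1 2 h1 v ∈ P := by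
    intro v hv
    have he : iota N N' 1 2 h1 v = E v + β • iota N N' ℓ 2 hℓ1 v := by rw [hEv, sub_add_cancel]
    rw [he]
    exact P.add_mem (Submodule.mem_sup_right (Submodule.mem_sup_left ⟨v, hv, rfl⟩)) (P.smul_mem _ (hJP v hv))
  have h2P : ∀ v ∈ V, iota N N' (ℓ * ℓ) 2 hℓ2 v ∈ P := by
    intro v hv
    have he : iota N N' (ℓ * ℓ) 2 hℓ2 v =
        (ℓ : ℂ)⁻¹ • (D v - iota N N' 1 2 h1 v + a • iota N N' ℓ 2 hℓ1 v) := by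
      have h' : D v - iota N N' 1 2 h1 v + a • iota N N' ℓ 2 hℓ1 v = (ℓ : ℂ) • iota N N' (ℓ * ℓ) 2 hℓ2 v := by
        rw [hDv]; module
      rw [h', smul_smul, inv_mul_cancel₀ hℓ0, one_smul]
    rw [he]
    exact P.smul_mem _ (P.add_mem (P.sub_mem (Submodule.mem_sup_left ⟨v, hv, rfl⟩) (h1P v hv))
      (P.smul_mem _ (hJP v hv)))
  -- the old forms `ι_d g`, `M₀ d ∣ N`, lie in `V`
  have hιV : ∀ {d : ℕ} [NeZero d] (hd : M₀ * d ∣ N), iota M₀ N d 2 hd g ∈ V := by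
    intro d _ hd
    have hℓd : ¬ ℓ ∣ d := fun h ↦ hℓN (h.trans ((dvd_mul_left d M₀).trans hd))
    rw [hV, heckeT_iota_of_not_dvd hd hℓ hℓd ⟨fun h ↦ absurd h hℓM₀, fun h ↦ absurd h hℓN⟩,
      hg.heckeT_eq_coeff_smul hℓ, map_smul, haℓ]
    rfl
  -- the `(N'/M₀)`-old forms of `g` lie in `P`
  have hle : Submodule.span ℂ
      {v | ∃ (d : ℕ) (_ : NeZero d), M₀ * d ∣ N' ∧ v = degeneracyMap0 M₀ N' d 2 g} ≤ P := by
    refine Submodule.span_le.mpr ?_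
    rintro _ ⟨d, _, hd, rfl⟩
    rw [SetLike.mem_coe, degeneracyMap0_eq_smul_iota M₀ N' d 2 hd]
    refine P.smul_mem _ ?_
    have hcopM₀ : Nat.Coprime M₀ ℓ := ((Nat.Prime.coprime_iff_not_dvd hℓ).mpr hℓM₀).symm
    by_cases hℓd : ℓ ∣ d
    · obtain ⟨e, rfl⟩ := hℓd
      haveI : NeZero e := ⟨fun h ↦ NeZero.ne (ℓ * e) (by rw [h, mul_zero])⟩
      by_cases hℓe : ℓ ∣ e
      · -- `d = ℓ² e'`, `ℓ ∤ e'`, `M₀ e' ∣ N`: `ι_d g = ι_{ℓ²} (ι_{e'} g)`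
        obtain ⟨e', rfl⟩ := hℓe
        haveI : NeZero e' := ⟨fun h ↦ NeZero.ne (ℓ * e') (by rw [h, mul_zero])⟩
        have hd' : M₀ * e' * (ℓ * ℓ) ∣ N * (ℓ * ℓ) := by
          rw [← hN']; simpa only [mul_comm, mul_assoc, mul_left_comm] using hd
        have he' : M₀ * e' ∣ N := Nat.dvd_of_mul_dvd_mul_right (mul_pos hℓ.pos hℓ.pos) hd'
        have hℓe' : ¬ ℓ ∣ e' := fun h ↦ hℓN (h.trans ((dvd_mul_left e' M₀).trans he'))
        have hd'' : M₀ * (e' * (ℓ * ℓ)) ∣ N' := by simpa only [mul_comm, mul_assoc, mul_left_comm] using hd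
        rw [iota_congr (show ℓ * (ℓ * e') = e' * (ℓ * ℓ) by ring) hd hd'' g,
          ← iota_iota (L := M₀) (M := N) (e := e') (d := ℓ * ℓ) he' hℓ2 hd'' g]
        exact h2P _ (hιV he')
      · -- `d = ℓ e`, `ℓ ∤ e`, `M₀ e ∣ N`: `ι_d g = ι_ℓ (ι_e g)`
        have hcop : Nat.Coprime (M₀ * e) ℓ := Nat.Coprime.mul_left hcopM₀ ((Nat.Prime.coprime_iff_not_dvd hℓ).mpr hℓe).symm
        have hd' : M₀ * e * ℓ ∣ N * ℓ * ℓ := by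
          rw [mul_assoc N, ← hN']; simpa only [mul_comm, mul_assoc, mul_left_comm] using hd
        have he1 : M₀ * e ∣ N * ℓ := Nat.dvd_of_mul_dvd_mul_right hℓ.pos hd'
        have he : M₀ * e ∣ N := hcop.dvd_of_dvd_mul_right he1
        have hd'' : M₀ * (e * ℓ) ∣ N' := by simpa only [mul_comm, mul_assoc, mul_left_comm] using hd
        rw [iota_congr (mul_comm ℓ e) hd hd'' g, ← iota_iota (L := M₀) (M := N) (e := e) (d := ℓ) he hℓ1 hd'' g]
        exact hJP _ (hιV he)
    · -- `ℓ ∤ d`, `M₀ d ∣ N`: `ι_d g = ι₁ (ι_d g)`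
      have hcop : Nat.Coprime (M₀ * d) (ℓ * ℓ) :=
        Nat.Coprime.mul_right (Nat.Coprime.mul_left hcopM₀ ((Nat.Prime.coprime_iff_not_dvd hℓ).mpr hℓd).symm)
          (Nat.Coprime.mul_left hcopM₀ ((Nat.Prime.coprime_iff_not_dvd hℓ).mpr hℓd).symm)
      have hd' : M₀ * d ∣ N := hcop.dvd_of_dvd_mul_right (by rw [← hN']; exact hd)
      have hd'' : M₀ * (d * 1) ∣ N' := by rw [mul_one]; exact hd
      rw [iota_congr (mul_one d).symm hd hd'' g, ← iota_iota (L := M₀) (M := N) (e := d) (d := 1) hd' h1 hd'' g]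
      exact h1P _ (hιV hd')
  -- coordinates: `k = D w₀ + y`, `y ∈ Y`
  obtain ⟨x, hx, y, hy, hxy⟩ := Submodule.mem_sup.mp (hle hmem)
  obtain ⟨w₀, hw₀, rfl⟩ := Submodule.mem_map.mp hx
  -- `U = U_ℓ` at level `N'`: `U (D v) = 0`, `U (E v) = α E v`, `U (J v) = E v + β J v` for `v ∈ V`
  set U : Module.End ℂ (CuspForm (Gamma0 N') 2) := heckeT (Gamma0 N') 2 ℓ with hUdef
  have hUD : ∀ v ∈ V, U (D v) = 0 := fun v hv ↦ by
    rw [hDv]; exact heckeT_goodDeplete_self h1 hℓ1 hℓ2 hN' hℓ hℓN (hV.mp hv)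
  have hUJ : ∀ v ∈ V, U (J v) = E v + β • J v := fun v hv ↦ by
    rw [hJv, hEv, hUdef, heckeT_iota_ell_goodLevel h1 hℓ1 hN' hℓ, sub_add_cancel]
  have hUE : ∀ v ∈ V, U (E v) = α • E v := fun v hv ↦ by
    rw [hEv, hUdef, map_sub, map_smul, heckeT_iota_one_goodLevel h1 hℓ1 hN' hℓ hℓN, hV.mp hv, map_smul,
      heckeT_iota_ell_goodLevel h1 hℓ1 hN' hℓ, hαdef]
    have hℓe : (ℓ : ℂ) = a * β - β ^ 2 := by linear_combination hβ
    rw [hℓe]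
    module
  -- `Y` is `U`-stable and `U² − aU + ℓ = 0` on `Y`; hence `U` is injective on `Y`
  have hYU : ∀ y ∈ Y, U y ∈ Y ∧ U (U y) - a • U y + (ℓ : ℂ) • y = 0 := by
    intro y hy
    obtain ⟨y₁, hy₁, y₂, hy₂, rfl⟩ := Submodule.mem_sup.mp hy
    obtain ⟨v₁, hv₁, rfl⟩ := Submodule.mem_map.mp hy₁
    obtain ⟨v₂, hv₂, rfl⟩ := Submodule.mem_map.mp hy₂
    have hU1 : U (E v₁ + J v₂) = E (α • v₁ + v₂) + J (β • v₂) := by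
      rw [map_add, hUE v₁ hv₁, hUJ v₂ hv₂, map_add, map_smul, map_smul]; abel
    refine ⟨?_, ?_⟩
    · rw [hU1]
      exact Submodule.add_mem _ (Submodule.mem_sup_left ⟨_, V.add_mem (V.smul_mem _ hv₁) hv₂, rfl⟩)
        (Submodule.mem_sup_right ⟨_, V.smul_mem _ hv₂, rfl⟩)
    · have hU2 : U (U (E v₁ + J v₂)) = E (α • (α • v₁ + v₂) + β • v₂) + J (β • (β • v₂)) := by
        rw [hU1, map_add, hUE _ (V.add_mem (V.smul_mem _ hv₁) hv₂), hUJ _ (V.smul_mem _ hv₂)]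
        simp only [map_add, map_smul]
        module
      rw [hU2, hU1]
      have ha : a = α + β := by rw [hαdef]; ring
      rw [ha, show (ℓ : ℂ) = α * β from hαβ.symm]
      simp only [map_add, map_smul]
      module
  have hYinj : ∀ y ∈ Y, U y = 0 → y = 0 := by
    intro y hy hUy
    have h := (hYU y hy).2
    rw [hUy, map_zero, smul_zero, sub_zero, zero_add, smul_eq_zero] at h
    exact h.resolve_left hℓ0
  have hYpow : ∀ (m : ℕ), ∀ y ∈ Y, (U ^ m) y = 0 → y = 0 := by
    intro m
    induction m with
    | zero => intro y _ h; rwa [pow_zero, Module.End.one_apply] at h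
    | succ m ih =>
      intro y hy h
      rw [pow_succ, Module.End.mul_apply] at h
      exact hYinj y hy (ih (U y) (hYU y hy).1 h)
  -- a power of `U_ℓ` kills `k`: its `Y`-component vanishes
  obtain ⟨m, hm⟩ := hk ℓ hℓ
  rw [hev hℓ, if_pos rfl, zero_smul, sub_zero] at hm
  rcases Nat.eq_zero_or_pos m with rfl | hmpos
  · rw [pow_zero, Module.End.one_apply] at hm
    exact absurd hm hk0
  have hDpow : (U ^ m) (D w₀) = 0 := by
    obtain ⟨m', rfl⟩ := Nat.exists_eq_add_of_lt hmpos
    rw [zero_add, pow_succ, Module.End.mul_apply, hUD w₀ hw₀, map_zero]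
  have hy0 : y = 0 := by
    apply hYpow m y hy
    have := hm
    rw [← hxy, map_add, hDpow, zero_add] at this
    exact this
  have hk₁ : k = D w₀ := by rw [← hxy, hy0, add_zero]
  -- `w₀` is a generalised eigenvector for the eigencharacter of `G` at level `N`
  have hw₀ev : ∀ p : ℕ, (hp : p.Prime) → ∃ n : ℕ,
      (haveI : NeZero p := ⟨hp.ne_zero⟩;
        ((heckeT (Gamma0 N) 2 p - heckeEigenvalue G p • (1 : Module.End ℂ (CuspForm (Gamma0 N) 2))) ^ n) w₀) = 0 := by
    intro p hp
    haveI : NeZero p := ⟨hp.ne_zero⟩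
    have hevG : heckeEigenvalue G p = cuspCoeff G p := heckeEigenvalue_eq_coeff_of_isNormalized hGnorm hp (hGeig p hp)
    by_cases hpℓ : p = ℓ
    · subst hpℓ
      refine ⟨1, ?_⟩
      rw [pow_one, LinearMap.sub_apply, LinearMap.smul_apply, Module.End.one_apply, hV.mp hw₀, hevG, sub_self]
    · obtain ⟨n, hn⟩ := hk p hp
      rw [hev hp, if_neg hpℓ, hk₁, ← hevG,
        pow_sub_smul_one_apply_comm D (heckeT (Gamma0 N) 2 p) (heckeT (Gamma0 N') 2 p)
          (fun v ↦ by rw [hDv, hDv]; exact heckeT_goodDeplete_of_ne h1 hℓ1 hℓ2 hN' hℓ hp hpℓ v a)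
          (heckeEigenvalue G p) n w₀, hDv] at hn
      exact ⟨n, eq_zero_of_goodDeplete_eq_zero h1 hℓ1 hℓ2 hℓ _ a hn⟩
  obtain ⟨c, hc⟩ := hGC w₀ hw₀ev
  exact ⟨c, by rw [hk₁, hc, map_smul]⟩

end Step

end Summit.BirchSwinnertonDyer.BirchSwinnertonDyer.Theorems.SmallImageRttKan

end
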